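import Summits.BirchSwinnertonDyer.BirchSwinnertonDyer.Theorems.ResidualThetaTransportAtTwoResidualSignedLambdaLowerCMAtTwoReciprocityExhaustion
import Summits.BirchSwinnertonDyer.BirchSwinnertonDyer.Theorems.ResidualThetaTransportAtTwoResidualSignedLambdaLowerCMAtTwoCofreeSelmerTransferKummer
import Summits.BirchSwinnertonDyer.BirchSwinnertonDyer.Theorems.ResidualThetaTransportAtTwoResidualSignedLambdaLowerCMAtTwoCofreeSelmerTransferRelaxedAtTwo
import Summits.BirchSwinnertonDyer.BirchSwinnertonDyer.Theorems.ResidualThetaTransportAtTwoResidualSignedLambdaLowerCMAtTwoRhoLayerPairingProjection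
import Literature.NumberTheory.GaloisRepresentations.ContinuousH1AddHomAlgebraProofs
import HarnessLib

/-!
# The level class of a relaxed Selmer class can be chosen with `loc_v b = thetaLayerKummer (2^K Q)` ON THE NOSE at every deep layer —
# the Θ-Kummer datum of (EH)'s test class READ AS A LAYER CLASS (crux RSL_g, line `onepair`, split stub EH `stub_reciprocity`)

Route `ResidualThetaTransportAtTwo` (RTT), crux RSL_g `ResidualSignedLambdaLowerCMAtTwo` (stmt-BirchSwinnertonDyer-22608), line «onepair»
(skeleton v3b), split stub EH `stub_reciprocity`; seat `prover-bsd-wall-tp2-p2x-w3` g17 (`--supports`, closes nothing). THEOREMS ONLY (no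
definition, no named fact, no instance, no `sorry`). BSD is not proved by any of this; RSL_g (22608) and K3 (20308) stay OPEN.

WHY. The 2-side term of (EH), `π₂.c₂ (π.locd₂ x) (locKer … π.v s)`, is pinned (`AtTwoPins.hc₂`) on a Θ-KUMMER DATUM `(ψ, Q, k)` of the local
class of `s`, and then (`OnePairPins.hlocd₂`/`hpair`, `rhoLayerPairingPk_apply`) equals the layer pairing of `loc_n(red x_n)` with
`thetaLayerKummer n (2^k Q)`; the S₀-side terms (`AwayPins.hlocdS`) and the levelwise reciprocity core (p688154) see the LAYER CLASS `loc_n b`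
of a level class `b` with `τ_{n,K} b = s`. The two second arguments have the same image in `D_v = H¹(ℚ_{∞,v}, A_ρ)` but need not agree in
`H¹(U_{n,v}, A_ρ[2^K])`. This file shows they DO agree at every sufficiently deep layer, for the datum read on `b` itself:
* §1 (generic `p`) **`exists_forall_layerLocOf_eq_thetaLayerKummer`** — if a cocycle `β` of `Γ_n` with values in `A_ρ[p^k]` satisfies the
  Θ-Kummer identity `ι(Θ(β(res τ))_i) = τ Q_i − Q_i` on `U_{∞,v}` with `p^k Q = P ∈ E(ℚ_{n₁,v})^r`, then for all `m' ≥ m` (some `m ≥ n, n₁`)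
  `layerLocOf (res_{Γ_{m'}} [β]) = thetaLayerKummer m' P`: the difference of `β ∘ res` and the explicit Θ-Kummer cocycle of the roots `Q`
  is a cocycle of `U_{max n n₁, v}` VANISHING on `U_{∞,v} = ⋂ₘ U_{m,v}` (read `Θ` off coordinatewise, `sum_thetaSingle`,
  `pointsMap_subgroupKummerCocycle_apply`, injectivity of `pointsMapOfEmb`/`Θ`), hence on some `U_{m,v}` (colimit-injectivity
  `Reciprocity.exists_forall_apply_eq_of_iInf`, p704367) — and restriction only re-reads the same values.
* §2 (`p = 2`, the habitat `GoodSS W 2`) **`exists_towerKummer_of_level_cocycle`** — every such `β` HAS a datum `Q` with the identity on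
  `U_{∞,v}` and `2^K Q ∈ E(ℚ_{∞,v})^r` (tower points = `U_{∞,v}`-fixed points, `Sprung2012.localTowerPointsOfEmb`):
  `CofreeSelmerTransfer.exists_towerKummer_of_cocycle` (p695679, Coates–Greenberg) applied to `β|_{Γ_∞}` with `Ψ = Θ ∘ (A_ρ[2^K] ↪ A_ρ)`; the
  exponent is brought back to `K` because the values of `β` are `2^K`-torsion.

References: [Kobayashi2003] §2 (p. 4), (8.23) (p. 18); [CoatesGreenberg1996] Cor. 3.2; [GreenbergLNM1716] §2 pp. 83–84;
[SerreGaloisCohomology1997] I §2.2 Prop. 8; [SilvermanAEC2009] VIII §2.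
-/

set_option autoImplicit false
-- the Theorems namespace of this sub repeats the summit name by design (D-0017 nested layout)
set_option linter.dupNamespace false

noncomputable section

open scoped Classical NumberField

namespace Summit.BirchSwinnertonDyer.BirchSwinnertonDyer.Theorems.ThetaTransport.Reciprocity

open CategoryTheory Field NumberField IsDedekindDomain
  Literature.NumberTheory.EllipticCurves Literature.NumberTheory.GaloisRepresentations
  Literature.NumberTheory.EllipticCurves.Kobayashi2003 Literature.NumberTheory.EllipticCurves.GreenbergVatsal2000
  Literature.NumberTheory.EllipticCurves.GreenbergSelmer Literature.NumberTheory.EllipticCurves.CyclotomicLayer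
  Literature.NumberTheory.GaloisCohomology ZpExtension
  Summit.BirchSwinnertonDyer.BirchSwinnertonDyer.Theorems

/-! ## §1 A Θ-Kummer identity on `U_{∞,v}` makes `loc b` the Θ-Kummer class at every deep layer -/

section Generic

variable {p : ℕ} [Fact p.Prime] (S : Set (PadicAlgCl p)) {d : ℕ} (ρ : FramedGaloisRep ℚ ↥(padicCoeffIntegers S) d)
  (k : ℕ) (W : WeierstrassCurve ℚ) [W.IsElliptic] {r : ℕ}
  (Θ : Cofree ρ ↥(padicCoeffField S) ≃+ (Fin r → ↥(W.geomPrimaryTorsion p))) (κ : ZpExtension ℚ p)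
  (v : HeightOneSpectrum (𝓞 ℚ))
  (hΘ : ∀ (δ : absoluteGaloisGroup (v.adicCompletion ℚ)) (m : Cofree ρ ↥(padicCoeffField S)) (i : Fin r),
    Θ (resGalOfEmb (closureEmb (K := ℚ) (v.adicCompletion ℚ)) δ • m) i =
      resGalOfEmb (closureEmb (K := ℚ) (v.adicCompletion ℚ)) δ • Θ m i)

omit [W.IsElliptic] in
/-- **Localisation commutes with restriction, GENERIC subgroups** `U' ≤ U ≤ Γ_ℚ`: pulling a class of `U` back to `Gal(ℚ̄_v/·) ∩ U'` along
`res` then `loc`, or `loc` then `res`, gives the same class (both are `[φ ∘ res]` on cocycles). Stated over subgroup VARIABLES so that the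
kernel's definitional check never unfolds a concrete layer. [cite: SerreGaloisCohomology1997, I §2.4] -/
theorem map_resGalSubgroupOfEmb_resLe {M : Type} [AddCommGroup M] [TopologicalSpace M] [DiscreteTopology M] (ρM : DiscreteGaloisModule ℚ M)
    {U U' : Subgroup (absoluteGaloisGroup ℚ)} (h : U' ≤ U)
    (h' : localSubgroupOfEmb U' (closureEmb (K := ℚ) (v.adicCompletion ℚ)) ≤ localSubgroupOfEmb U (closureEmb (K := ℚ) (v.adicCompletion ℚ)))
    (c : continuousCohomology 1 (subgroupRep ρM.toTopRep U)) :
    ContinuousCohomology.map (resGalSubgroupOfEmb U' (closureEmb (K := ℚ) (v.adicCompletion ℚ)))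
        (X := subgroupRep ρM.toTopRep U')
        (Y := subgroupRep (localRepOf ρM v) (localSubgroupOfEmb U' (closureEmb (K := ℚ) (v.adicCompletion ℚ))))
        (TopRep.ofHom ⟨ContinuousLinearMap.id ℤ M, fun _ ↦ rfl⟩) 1 (resLe ρM.toTopRep h 1 c) =
      resLe (localRepOf ρM v) h' 1
        (ContinuousCohomology.map (resGalSubgroupOfEmb U (closureEmb (K := ℚ) (v.adicCompletion ℚ)))
          (X := subgroupRep ρM.toTopRep U)
          (Y := subgroupRep (localRepOf ρM v) (localSubgroupOfEmb U (closureEmb (K := ℚ) (v.adicCompletion ℚ))))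
          (TopRep.ofHom ⟨ContinuousLinearMap.id ℤ M, fun _ ↦ rfl⟩) 1 c) := by
  obtain ⟨φ, rfl⟩ := oneCocycleClass_surjective _ c
  rw [resLe_oneCocycleClass, map_oneCocycleClass, map_oneCocycleClass, resLe_oneCocycleClass]
  exact congrArg _ (Subtype.ext (ContinuousMap.ext fun _ ↦ rfl))

omit [W.IsElliptic] in
/-- **`loc` commutes with restriction along the layers**: `loc_m (res_{Γ_m ≤ Γ_n} c) = res_{U_m ≤ U_n} (loc_n c)` (the generic
`map_resGalSubgroupOfEmb_resLe` at `U = Γ_n`, `U' = Γ_m`). [cite: SerreGaloisCohomology1997, I §2.4] [cite: Kobayashi2003, (8.23) (p. 18)] -/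
theorem layerLocOf_resLe {M : Type} [AddCommGroup M] [TopologicalSpace M] [DiscreteTopology M] (ρM : DiscreteGaloisModule ℚ M)
    {n m : ℕ} (hnm : n ≤ m) (c : H1 ρM (κ.layerSubgroup n)) :
    layerLocOf ρM κ v m (resLe ρM.toTopRep (κ.layerSubgroup_antitone hnm) 1 c) =
      resLe (localRepOf ρM v) (ProfiniteExhaustion.antitone_layerGroup κ v hnm) 1 (layerLocOf ρM κ v n c) :=
  map_resGalSubgroupOfEmb_resLe v ρM (κ.layerSubgroup_antitone hnm) (ProfiniteExhaustion.antitone_layerGroup κ v hnm) c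

include hΘ in
/-- **Restriction of the Θ-Kummer classes along the layers, any number of steps**: `res_{U_m ≤ U_n} (thetaLayerKummer_n Q) = thetaLayerKummer_m Q`
for `Q ∈ E(ℚ_{n,v})^r ⊆ E(ℚ_{m,v})^r` (iterate `resLe_thetaLayerKummer`). [cite: Kobayashi2003, §2 (p. 4)] [cite: SilvermanAEC2009, X §4] -/
theorem resLe_thetaLayerKummer_of_le {n m : ℕ} (hnm : n ≤ m) (Q : Fin r → localPoints W (v.adicCompletion ℚ))
    (hQ : ∀ i, Q i ∈ localLayerPointsOfEmb κ (closureEmb (K := ℚ) (v.adicCompletion ℚ)) W n) :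
    haveI : NeZero (p ^ k) := ⟨pow_ne_zero k (Fact.out : p.Prime).ne_zero⟩
    resLe (cofreeTorsionLocalRep S ρ ((p ^ k : ℕ) : ℤ) v) (ProfiniteExhaustion.antitone_layerGroup κ v hnm) 1
        (thetaLayerKummer S ρ k W Θ κ v hΘ n (fun i ↦ ⟨Q i, hQ i⟩)) =
      thetaLayerKummer S ρ k W Θ κ v hΘ m
        (fun i ↦ ⟨Q i, localLayerPointsOfEmb_mono κ (closureEmb (K := ℚ) (v.adicCompletion ℚ)) W hnm (hQ i)⟩) := by
  haveI : NeZero (p ^ k) := ⟨pow_ne_zero k (Fact.out : p.Prime).ne_zero⟩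
  induction m, hnm using Nat.le_induction with
  | base => exact resLe_refl_apply _ _
  | succ m hnm ih =>
    rw [← resLe_resLe_apply _ (SignedKatoOffTwo.LayerPairing.layerGroup_antitone κ v m) (ProfiniteExhaustion.antitone_layerGroup κ v hnm),
      ih, resLe_thetaLayerKummer]

-- the coercion towers `A_ρ[p^k] ↪ A_ρ →Θ E[p^∞]^r ↪ E(ℚ̄)^r → E(ℚ̄_v)^r` and the two cohomology dialects make the defeq checks slow
-- (as in `…CofreeSelmerTransferKummer`)
set_option maxHeartbeats 1600000 in
include hΘ in
/-- **A Θ-Kummer identity on `U_{∞,v}` determines the layer class at every deep layer.** Let `β` be a cocycle of `Γ_n` with values in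
`A_ρ[p^k]`, `Q, P : Fin r → E(ℚ̄_v)` with `p^k • Q i = P i ∈ E(ℚ_{n₁,v})`, and suppose `ι(Θ(β(res τ))_i) = τ Q_i − Q_i` for all
`τ ∈ U_{∞,v} = Gal(ℚ̄_v/ℚ_{∞,v})`. Then there is `m ≥ max n n₁` such that for every `m' ≥ m` the localisation at layer `m'` of `res_{Γ_{m'}} [β]`
IS the Θ-transported layer Kummer class of `P`: `layerLocOf … m' (res [β]) = thetaLayerKummer … m' P`.
[cite: Kobayashi2003, §2 (p. 4), (8.23) (p. 18)] [cite: SerreGaloisCohomology1997, I §2.2 Prop. 8] [cite: SilvermanAEC2009, VIII §2] -/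
theorem exists_forall_layerLocOf_eq_thetaLayerKummer (n n₁ : ℕ)
    (β : contOneCocycles (subgroupRep (cofreeTorsionGaloisModule S ρ ((p ^ k : ℕ) : ℤ)).toTopRep (κ.layerSubgroup n)))
    (Q P : Fin r → localPoints W (v.adicCompletion ℚ)) (hP : ∀ i, (p ^ k) • Q i = P i)
    (hPn₁ : ∀ i, P i ∈ localLayerPointsOfEmb κ (closureEmb (K := ℚ) (v.adicCompletion ℚ)) W n₁)
    (hid : ∀ (τ : kerGroup κ v) (i : Fin r),
      pointsMapOfEmb W (closureEmb (K := ℚ) (v.adicCompletion ℚ))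
        ((Θ ((β.1 (Literature.NumberTheory.EllipticCurves.subgroupInclusion (κ.kerSubgroup_le_layerSubgroup n)
            (resGalSubgroupOfEmb κ.kerSubgroup (closureEmb (K := ℚ) (v.adicCompletion ℚ)) τ)) :
            ↥(AddSubgroup.torsionBy (Cofree ρ ↥(padicCoeffField S)) ((p ^ k : ℕ) : ℤ))) : Cofree ρ ↥(padicCoeffField S)) i :
          ↥(W.geomPrimaryTorsion p)) : W.geomPoints) =
        (τ : absoluteGaloisGroup (v.adicCompletion ℚ)) • Q i - Q i) :
    ∃ (m : ℕ) (hm : max n n₁ ≤ m), ∀ (m' : ℕ) (hm' : m ≤ m'),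
      layerLocOf (cofreeTorsionGaloisModule S ρ ((p ^ k : ℕ) : ℤ)) κ v m'
          (resLe (cofreeTorsionGaloisModule S ρ ((p ^ k : ℕ) : ℤ)).toTopRep
            (κ.layerSubgroup_antitone ((le_max_left n n₁).trans (hm.trans hm'))) 1 (oneCocycleClass _ β)) =
        thetaLayerKummer S ρ k W Θ κ v hΘ m'
          (fun i ↦ ⟨P i, localLayerPointsOfEmb_mono κ (closureEmb (K := ℚ) (v.adicCompletion ℚ)) W
            ((le_max_right n n₁).trans (hm.trans hm')) (hPn₁ i)⟩) := by
  haveI : NeZero (p ^ k) := ⟨pow_ne_zero k (Fact.out : p.Prime).ne_zero⟩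
  have hN : ((p ^ k : ℕ) : ℤ) ≠ 0 := by exact_mod_cast pow_ne_zero k (Fact.out : p.Prime).ne_zero
  haveI : CompactSpace (absoluteGaloisGroup (v.adicCompletion ℚ)) := absoluteGaloisGroup_compactSpace _
  -- roots: `p^k • Q i` is fixed at the layer `n₂ := max n n₁`
  have hfix : ∀ i, ((p ^ k : ℕ) : ℤ) • Q i ∈
      FixedPoints.addSubgroup (layerGroup κ v (max n n₁)) (localPoints W (v.adicCompletion ℚ)) := fun i ↦ by
    rw [natCast_zsmul, hP]
    exact localLayerPointsOfEmb_mono κ (closureEmb (K := ℚ) (v.adicCompletion ℚ)) W (le_max_right n n₁) (hPn₁ i)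
  -- the Θ-Kummer class at layer `n₂` as ONE explicit cocycle on the roots `Q`
  have hT : thetaLayerKummer S ρ k W Θ κ v hΘ (max n n₁)
        (fun i ↦ ⟨P i, localLayerPointsOfEmb_mono κ (closureEmb (K := ℚ) (v.adicCompletion ℚ)) W (le_max_right n n₁) (hPn₁ i)⟩) =
      oneCocycleClass (subgroupRep (cofreeTorsionLocalRep S ρ ((p ^ k : ℕ) : ℤ) v) (layerGroup κ v (max n n₁)))
        (∑ i, contOneCocycles.pushAddHom (thetaSingle ρ p k W Θ i) continuous_of_discreteTopology
          (thetaSingle_subgroupRep S ρ k W Θ κ v hΘ i (max n n₁))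
          (W.subgroupKummerCocycle ((p ^ k : ℕ) : ℤ) (layerGroup κ v (max n n₁)) hN (Q i) (hfix i))) := by
    have hK : ∀ i, layerKummer W (p ^ k) κ v (max n n₁)
        ⟨P i, localLayerPointsOfEmb_mono κ (closureEmb (K := ℚ) (v.adicCompletion ℚ)) W (le_max_right n n₁) (hPn₁ i)⟩ =
        oneCocycleClass _ (W.subgroupKummerCocycle ((p ^ k : ℕ) : ℤ) (layerGroup κ v (max n n₁)) hN (Q i) (hfix i)) := fun i ↦ by
      change W.subgroupKummerMap ((p ^ k : ℕ) : ℤ) (layerGroup κ v (max n n₁)) hN _ = _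
      rw [W.subgroupKummerMap_apply_eq _ _ hN _ (Q i) (hfix i) (by rw [natCast_zsmul, hP])]
      rfl
    rw [thetaLayerKummer_apply, ← oneCocycleClassₗ_apply, map_sum]
    refine Finset.sum_congr rfl fun i _ ↦ ?_
    rw [oneCocycleClassₗ_apply, hK i, thetaSingleH1_oneCocycleClass]
  -- the two cocycles at layer `n₂`: `β ∘ res` and the Θ-Kummer cocycle of the roots `Q`
  let φ₁ : contOneCocycles (subgroupRep (cofreeTorsionLocalRep S ρ ((p ^ k : ℕ) : ℤ) v) (layerGroup κ v (max n n₁))) :=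
    contOneCocycles.pullback (resGalSubgroupOfEmb (κ.layerSubgroup (max n n₁)) (closureEmb (K := ℚ) (v.adicCompletion ℚ)))
        (X := subgroupRep (cofreeTorsionGaloisModule S ρ ((p ^ k : ℕ) : ℤ)).toTopRep (κ.layerSubgroup (max n n₁)))
        (Y := subgroupRep (localRepOf (cofreeTorsionGaloisModule S ρ ((p ^ k : ℕ) : ℤ)) v) (layerGroup κ v (max n n₁)))
        (TopRep.ofHom ⟨ContinuousLinearMap.id ℤ _, fun _ ↦ rfl⟩)
        (contOneCocycles.pullback (Literature.NumberTheory.EllipticCurves.subgroupInclusion (κ.layerSubgroup_antitone (le_max_left n n₁)))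
          (TopRep.ofHom ⟨ContinuousLinearMap.id ℤ _, fun _ ↦ rfl⟩) β)
  let φ₂ : contOneCocycles (subgroupRep (cofreeTorsionLocalRep S ρ ((p ^ k : ℕ) : ℤ) v) (layerGroup κ v (max n n₁))) :=
    ∑ i, contOneCocycles.pushAddHom (thetaSingle ρ p k W Θ i) continuous_of_discreteTopology
        (thetaSingle_subgroupRep S ρ k W Θ κ v hΘ i (max n n₁))
        (W.subgroupKummerCocycle ((p ^ k : ℕ) : ℤ) (layerGroup κ v (max n n₁)) hN (Q i) (hfix i))
  have hφ₂ : ∀ g : layerGroup κ v (max n n₁), φ₂.1 g = ∑ i, thetaSingle ρ p k W Θ i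
      ((W.subgroupKummerCocycle ((p ^ k : ℕ) : ℤ) (layerGroup κ v (max n n₁)) hN (Q i) (hfix i)).1 g) := by
    intro g
    change (∑ i, contOneCocycles.pushAddHom
        (X := subgroupRep (torsionLocalRep W (p ^ k) v) (layerGroup κ v (max n n₁)))
        (Y := subgroupRep (cofreeTorsionLocalRep S ρ ((p ^ k : ℕ) : ℤ) v) (layerGroup κ v (max n n₁)))
        (thetaSingle ρ p k W Θ i) continuous_of_discreteTopology
        (thetaSingle_subgroupRep S ρ k W Θ κ v hΘ i (max n n₁))
        (W.subgroupKummerCocycle ((p ^ k : ℕ) : ℤ) (layerGroup κ v (max n n₁)) hN (Q i) (hfix i))).1 g = _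
    rw [Submodule.coe_sum, ContinuousMap.sum_apply]
    rfl
  -- values of `φ₁` on `U_{∞,v}`: `β` at `res g`
  have hφ₁ : ∀ g : kerGroup κ v,
      φ₁.1 (Literature.NumberTheory.EllipticCurves.subgroupInclusion (kerGroup_le_layerGroup κ v (max n n₁)) g) =
        β.1 (Literature.NumberTheory.EllipticCurves.subgroupInclusion (κ.kerSubgroup_le_layerSubgroup n)
          (resGalSubgroupOfEmb κ.kerSubgroup (closureEmb (K := ℚ) (v.adicCompletion ℚ)) g)) := fun _ ↦ rfl
  -- their difference vanishes on `U_{∞,v}` (read `Θ` off coordinatewise)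
  have hδ0 : resLe (cofreeTorsionLocalRep S ρ ((p ^ k : ℕ) : ℤ) v) (kerGroup_le_layerGroup κ v (max n n₁)) 1
      (oneCocycleClass _ (φ₁ - φ₂)) = 0 := by
    rw [resLe_oneCocycleClass, oneCocycleClass_eq_zero_iff]
    refine ⟨0, fun g ↦ ?_⟩
    rw [contOneCocycles.pullback_apply, map_zero, sub_zero]
    change (φ₁ - φ₂).1 (Literature.NumberTheory.EllipticCurves.subgroupInclusion (kerGroup_le_layerGroup κ v (max n n₁)) g) = 0
    rw [Submodule.coe_sub, ContinuousMap.sub_apply, sub_eq_zero, hφ₂, hφ₁ g]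
    apply Subtype.ext
    rw [AddSubmonoidClass.coe_finsetSum, sum_thetaSingle]
    apply Θ.injective
    rw [AddEquiv.apply_symm_apply]
    funext i
    apply Subtype.ext
    apply pointsMapOfEmb_injective W (closureEmb (K := ℚ) (v.adicCompletion ℚ))
    have hkum : pointsMapOfEmb W (closureEmb (K := ℚ) (v.adicCompletion ℚ))
        (((W.subgroupKummerCocycle ((p ^ k : ℕ) : ℤ) (layerGroup κ v (max n n₁)) hN (Q i) (hfix i)).1
          (Literature.NumberTheory.EllipticCurves.subgroupInclusion (kerGroup_le_layerGroup κ v (max n n₁)) g) :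
          W.geomTorsion ((p ^ k : ℕ) : ℤ)) : W.geomPoints) =
        ((Literature.NumberTheory.EllipticCurves.subgroupInclusion (kerGroup_le_layerGroup κ v (max n n₁)) g :
          layerGroup κ v (max n n₁)) : absoluteGaloisGroup (v.adicCompletion ℚ)) • Q i - Q i :=
      W.pointsMap_subgroupKummerCocycle_apply _ _ hN (Q i) (hfix i) _
    rw [AddSubgroup.coe_inclusion, hkum]
    exact hid g i
  -- colimit-injectivity: the difference dies on some `U_{m,v}`
  have hcol := exists_resLe_eq_zero_of_resLe_eq_zero (cofreeTorsionLocalRep S ρ ((p ^ k : ℕ) : ℤ) v)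
    (fun a ↦ (GaloisRep.restrictField (v.adicCompletion ℚ) (cofreeTorsionGaloisModule S ρ ((p ^ k : ℕ) : ℤ))).continuous_apply_left a)
    (layerGroup κ v) (ProfiniteExhaustion.antitone_layerGroup κ v) (isOpen_layerGroup κ v)
    (T := kerGroup κ v) (by rw [ProfiniteExhaustion.kerGroup_eq_iInf_layerGroup])
    (max n n₁) (kerGroup_le_layerGroup κ v (max n n₁)) _ hδ0
  obtain ⟨m, hm₂, hm⟩ := hcol
  refine ⟨m, hm₂, fun m' hm' ↦ ?_⟩
  -- on `U_{m'}`: `res [φ₁] = res [φ₂]`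
  have h1 : resLe (cofreeTorsionLocalRep S ρ ((p ^ k : ℕ) : ℤ) v) (ProfiniteExhaustion.antitone_layerGroup κ v (hm₂.trans hm')) 1
        (oneCocycleClass _ φ₁) =
      resLe (cofreeTorsionLocalRep S ρ ((p ^ k : ℕ) : ℤ) v) (ProfiniteExhaustion.antitone_layerGroup κ v (hm₂.trans hm')) 1
        (oneCocycleClass _ φ₂) := by
    have h0 := hm
    rw [← sub_eq_zero, ← map_sub, ← oneCocycleClass_sub,
      ← resLe_resLe_apply _ (ProfiniteExhaustion.antitone_layerGroup κ v hm') (ProfiniteExhaustion.antitone_layerGroup κ v hm₂), h0, map_zero]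
  -- read the two sides
  have hL : layerLocOf (cofreeTorsionGaloisModule S ρ ((p ^ k : ℕ) : ℤ)) κ v m'
        (resLe (cofreeTorsionGaloisModule S ρ ((p ^ k : ℕ) : ℤ)).toTopRep
          (κ.layerSubgroup_antitone ((le_max_left n n₁).trans (hm₂.trans hm'))) 1 (oneCocycleClass _ β)) =
      resLe (cofreeTorsionLocalRep S ρ ((p ^ k : ℕ) : ℤ) v) (ProfiniteExhaustion.antitone_layerGroup κ v (hm₂.trans hm')) 1
        (oneCocycleClass _ φ₁) := by
    rw [← resLe_resLe_apply _ (κ.layerSubgroup_antitone (hm₂.trans hm')) (κ.layerSubgroup_antitone (le_max_left n n₁)),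
      layerLocOf_resLe (hnm := hm₂.trans hm'), resLe_oneCocycleClass, layerLocOf_oneCocycleClass]
  rw [hL, h1, ← hT]
  have hfinal := resLe_thetaLayerKummer_of_le S ρ k W Θ κ v hΘ (hm₂.trans hm') P
    (fun i ↦ localLayerPointsOfEmb_mono κ (closureEmb (K := ℚ) (v.adicCompletion ℚ)) W (le_max_right n n₁) (hPn₁ i))
  exact hfinal

end Generic

/-! ## §2 At `v ∣ 2` on the habitat: every level cocycle HAS a Θ-Kummer datum on `U_{∞,v}` with exponent its own level -/

section AtTwo

variable (W : WeierstrassCurve ℚ) [W.IsElliptic] [W.IsGloballyMinimal] (S : Set (PadicAlgCl 2)) {d : ℕ}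
  (ρ : FramedGaloisRep ℚ ↥(padicCoeffIntegers S) d)
  {r : ℕ} (Θ : Cofree ρ ↥(padicCoeffField S) ≃+ (Fin r → ↥(W.geomPrimaryTorsion 2))) (κ : ZpExtension ℚ 2)
  (v : HeightOneSpectrum (𝓞 ℚ))
  (hΘ : ∀ (δ : absoluteGaloisGroup (v.adicCompletion ℚ)) (m : Cofree ρ ↥(padicCoeffField S)) (i : Fin r),
    Θ (resGalOfEmb (closureEmb (K := ℚ) (v.adicCompletion ℚ)) δ • m) i =
      resGalOfEmb (closureEmb (K := ℚ) (v.adicCompletion ℚ)) δ • Θ m i)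

include hΘ in
/-- **Θ-Kummer data for level cocycles at `v ∣ 2`.** On the habitat (`GoodSS W 2`, `κ` cyclotomic, `2 ∈ v`), every cocycle `β` of `Γ_n` with
values in `A_ρ[2^K]` has roots `Q : Fin r → E(ℚ̄_v)` with `ι(Θ(β(res τ))_i) = τ Q_i − Q_i` for all `τ ∈ U_{∞,v}` AND `2^K Q_i ∈ E(ℚ_{∞,v})`
(tower points): `CofreeSelmerTransfer.exists_towerKummer_of_cocycle` (Coates–Greenberg, p695679) for `β|_{Γ_∞}` read through
`Θ ∘ (A_ρ[2^K] ↪ A_ρ)`, the exponent lowered to `K` because `2^K` kills the values of `β` (tower points = `U_{∞,v}`-fixed points).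
[cite: CoatesGreenberg1996, Cor. 3.2] [cite: GreenbergLNM1716, §2 pp. 83–84] [cite: Sprung2012, §1 p. 1486] -/
theorem exists_towerKummer_of_level_cocycle (hGood : Rank1Residual.GoodSS W 2) (hκ : κ.IsCyclotomic)
    (hv : ((2 : ℕ) : 𝓞 ℚ) ∈ v.asIdeal) (K n : ℕ)
    (β : contOneCocycles (subgroupRep (cofreeTorsionGaloisModule S ρ ((2 ^ K : ℕ) : ℤ)).toTopRep (κ.layerSubgroup n))) :
    ∃ Q : Fin r → localPoints W (v.adicCompletion ℚ),
      (∀ i, (2 ^ K) • Q i ∈ Sprung2012.localTowerPointsOfEmb κ (closureEmb (K := ℚ) (v.adicCompletion ℚ)) W) ∧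
      ∀ (τ : kerGroup κ v) (i : Fin r),
        pointsMapOfEmb W (closureEmb (K := ℚ) (v.adicCompletion ℚ))
          ((Θ ((β.1 (Literature.NumberTheory.EllipticCurves.subgroupInclusion (κ.kerSubgroup_le_layerSubgroup n)
              (resGalSubgroupOfEmb κ.kerSubgroup (closureEmb (K := ℚ) (v.adicCompletion ℚ)) τ)) :
              ↥(AddSubgroup.torsionBy (Cofree ρ ↥(padicCoeffField S)) ((2 ^ K : ℕ) : ℤ))) : Cofree ρ ↥(padicCoeffField S)) i :
            ↥(W.geomPrimaryTorsion 2)) : W.geomPoints) =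
          (τ : absoluteGaloisGroup (v.adicCompletion ℚ)) • Q i - Q i := by
  have hK := CofreeSelmerTransfer.exists_towerKummer_of_cocycle W hGood κ hκ v hv
    (A := ↥(AddSubgroup.torsionBy (Cofree ρ ↥(padicCoeffField S)) ((2 ^ K : ℕ) : ℤ)))
    (Θ.toAddMonoidHom.comp (AddSubgroup.torsionBy (Cofree ρ ↥(padicCoeffField S)) ((2 ^ K : ℕ) : ℤ)).subtype)
    (fun δ m i ↦ by
      change Θ (((resGalOfEmb (closureEmb (K := ℚ) (v.adicCompletion ℚ)) δ • m :
          ↥(AddSubgroup.torsionBy (Cofree ρ ↥(padicCoeffField S)) ((2 ^ K : ℕ) : ℤ))) : Cofree ρ ↥(padicCoeffField S))) i =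
        resGalOfEmb (closureEmb (K := ℚ) (v.adicCompletion ℚ)) δ • Θ (m : Cofree ρ ↥(padicCoeffField S)) i
      rw [Literature.NumberTheory.EllipticCurves.AddSubgroup.torsionBy.coe_smul, hΘ])
    (contOneCocycles.pullback (Literature.NumberTheory.EllipticCurves.subgroupInclusion (κ.kerSubgroup_le_layerSubgroup n))
      (X := subgroupRep (cofreeTorsionGaloisModule S ρ ((2 ^ K : ℕ) : ℤ)).toTopRep (κ.layerSubgroup n))
      (Y := subgroupRep (cofreeTorsionGaloisModule S ρ ((2 ^ K : ℕ) : ℤ)).toTopRep κ.kerSubgroup)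
      (TopRep.ofHom ⟨ContinuousLinearMap.id ℤ _, fun _ ↦ rfl⟩) β)
  obtain ⟨Q, k', -, hid⟩ := hK
  have hid' : ∀ (τ : kerGroup κ v) (i : Fin r),
      pointsMapOfEmb W (closureEmb (K := ℚ) (v.adicCompletion ℚ))
        ((Θ ((β.1 (Literature.NumberTheory.EllipticCurves.subgroupInclusion (κ.kerSubgroup_le_layerSubgroup n)
            (resGalSubgroupOfEmb κ.kerSubgroup (closureEmb (K := ℚ) (v.adicCompletion ℚ)) τ)) :
            ↥(AddSubgroup.torsionBy (Cofree ρ ↥(padicCoeffField S)) ((2 ^ K : ℕ) : ℤ))) : Cofree ρ ↥(padicCoeffField S)) i :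
          ↥(W.geomPrimaryTorsion 2)) : W.geomPoints) =
        (τ : absoluteGaloisGroup (v.adicCompletion ℚ)) • Q i - Q i := fun τ i ↦ hid τ i
  refine ⟨Q, fun i ↦ ?_, hid'⟩
  rw [Sprung2012.mem_localTowerPointsOfEmb_iff]
  intro τ hτ
  have h := hid' ⟨τ, hτ⟩ i
  -- `2^K` kills the value of `β`, hence `τ • Q i − Q i`
  have hb : (2 ^ K) • ((β.1 (Literature.NumberTheory.EllipticCurves.subgroupInclusion (κ.kerSubgroup_le_layerSubgroup n)
      (resGalSubgroupOfEmb κ.kerSubgroup (closureEmb (K := ℚ) (v.adicCompletion ℚ)) ⟨τ, hτ⟩)) :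
      ↥(AddSubgroup.torsionBy (Cofree ρ ↥(padicCoeffField S)) ((2 ^ K : ℕ) : ℤ))) : Cofree ρ ↥(padicCoeffField S)) = 0 := by
    rw [← natCast_zsmul]
    exact (Submodule.mem_torsionBy_iff (R := ℤ) _ _).mp (β.1 _).2
  have h2 : (2 ^ K) • ((τ : absoluteGaloisGroup (v.adicCompletion ℚ)) • Q i - Q i) = 0 := by
    rw [← h, ← map_nsmul, ← AddSubmonoidClass.coe_nsmul, ← Pi.smul_apply, ← map_nsmul, hb, map_zero, Pi.zero_apply,
      ZeroMemClass.coe_zero, map_zero]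
  rw [smul_sub, sub_eq_zero] at h2
  change (τ : absoluteGaloisGroup (v.adicCompletion ℚ)) • ((2 ^ K) • Q i) = (2 ^ K) • Q i
  rw [smul_comm, h2]

end AtTwo

end Summit.BirchSwinnertonDyer.BirchSwinnertonDyer.Theorems.ThetaTransport.Reciprocity

end
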